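import Literature.AlgebraicGeometry.AbelianSchemes.SerreTensorHomOfIdealFamily
import Literature.AlgebraicGeometry.AbelianSchemes.QuotientDualPairKernelLawOfIdealClass
import Literature.AlgebraicGeometry.AbelianSchemes.RoofMiddleDualOfIdealTorsionQuotient
import HarnessLib

/-!
# The isogeny roof `A₁ —q→ A₂ ⊗_𝒪 𝔟 ←ψ_P— A₂` of a `𝔭`-family of homomorphisms over an ALGEBRAICALLY CLOSED field, with the dual pair, unit pin and
# cover-exact `λ_𝔟` of the middle DISCHARGED ([MumfordAV1970] §15 Thm. 1, §23 Thm. 2; [Conrad2004GrossZagier] §7 Thm. 7.5; [RapoportSmithlingZhang2020Diagonal] (4.23))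

Topic `AlgebraicGeometry/AbelianSchemes`, namespace `Literature.AlgebraicGeometry.AbelianSchemes.AbelianSchemeOver`.  THEOREMS ONLY (no definition, no named fact,
no `instance`, no notation, no `sorry`).  Cell `hodgecm-mathlib` (D-0151), F0∕P6 «MOD», «GO 500» half A line L4∕L5 (X-LEAF socket `stub_EHECKE`, closer leaf
`Lines/F0_P6a_StubEHECKE.lean` of LA5-plan (g3), organ stubs `stub_ER1`∕`stub_ER2`): **organ (O-B) §4 — the head of ★ `SerreTensorHomOfIdealFamily` (p849932) with its
three middle inputs `(D_𝔟, unit pin, λ_𝔟 with ψ_P ≫ λ_𝔟 ≫ ψ_P^∨ = λ₂ ≫ [N])` PAID by the (ρ-𝔟) ★ pair of line L3** (★ `exists_idealClass_quotient_kernelLaw_dualPair` → ★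
`exists_dualPair_comp_lam_comp_dualIsogenyOver_eq_mulN_of_kernelLaws'`, at the cover `cb := ψ_P`); A-p06 (g35); `--supports stmt-HodgeConjecture-24832`, count-neutral.
HONEST LABEL: HC_CM is proved only modulo the 7 printed citations (2 remaining: hLiu418 = stmt-HodgeConjecture-24832, h413 = stmt-HodgeConjecture-24833) until rung 0
closes; this file is generic and discharges none of them.

## Mathematics

Over `Spec Ω`, `Ω` algebraically closed, let `A₂` carry an action `ι₂` of the integers `𝓞 F` of a number field, a dual pair `D₂` (unit pin) and a POLARISATION `λ₂` (i.e.
`Λ(𝒪(Θ))` for an ample `Θ` at every geometric point) with the ROSATI LAW `ι₂(c b) ≫ λ₂ = λ₂ ≫ ι₂(b)^∨` for a ring involution `c` of `𝓞 F`; let `𝔭 ≠ 0` be presented à la Serre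
by `(E′, P, Q, N)` (`𝔟 = E′·𝒪ᵐ ≅ 𝔭⁻¹`, coordinates of `P` generating `𝔭`, `QP = N`) with `𝔭·c(𝔭)·𝔡 = (N)` (e.g. `𝔭 = 𝔭_w`, `c` = complex conjugation, `N = p ∈ 𝔭_w`), and let
`M ≥ 1` be divisible by the characteristic of `Ω` if positive.  (ρ-𝔟) ★ `exists_idealClass_quotient_kernelLaw_dualPair` gives an ideal `𝔟′ = x·𝔭` in the class of `𝔭`, the free
quotient `q_K : A₂ → Q := A₂ ∕ A₂[𝔟′]` with its ideal-shape kernel law, and a dual pair `D_Q` with unit pin; the cover `ψ_P : A₂ → A₂ ⊗_𝒪 𝔟` is a surjective homomorphism with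
kernel law `A₂[𝔭]` (★ `surjective_serreTranslate_left`, ★ `comp_serreTranslate_eq_one_iff_forall_mem`); hence ★ `exists_dualPair_comp_lam_comp_dualIsogenyOver_eq_mulN_of_kernelLaws'`
(class invariance `Q ≅ A₂ ⊗ 𝔟`, the `c`-invariant scalar, the twist homomorphism, conjugation cancel) yields **a dual pair `D_𝔟` of `A₂ ⊗_𝒪 𝔟` with unit pin and
`λ_𝔟 : A₂ ⊗ 𝔟 → (A₂ ⊗ 𝔟)^` with `ψ_P ≫ λ_𝔟 ≫ ψ_P^∨ = λ₂ ≫ [N]`** — exactly the three inputs of ★ `exists_roof_of_idealHomFamily`.  Feeding them, a `𝔭`-FAMILY OF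
HOMOMORPHISMS `h : 𝔭 → Hom(A₁, A₂)` (`𝒪`-linear for `x • f = f ≫ ι₂(x)`, `ι₁`-equivariant, with the similitude law at `N` and the level law on chosen points) spans the
ISOGENY ROOF `A₁ —q→ A₂ ⊗_𝒪 𝔟 ←ψ_P— A₂` with the clauses (r1)(r2)(surjective)(r3)(r3)(r4)(r5) of the P6a reader `RoofΩ`∕`RoofAt`, NO dual-pair input left
([RapoportSmithlingZhang2020Diagonal] §4.3 (4.23): the Hecke correspondence at a split place through `A ⊗ 𝔭⁻¹`; [Kottwitz1992] §5 pp. 389–391).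

## Contents
* `exists_serreTensor_dualPair_coverExact` — `(D_𝔟, pin, λ_𝔟, IsMonHom λ_𝔟, ψ_P ≫ λ_𝔟 ≫ ψ_P^∨ = λ₂ ≫ [N])` for the Serre tensor by `𝔟 ≅ 𝔭⁻¹` over an algebraically closed field;
* **`exists_roof_of_idealHomFamily_of_isAlgClosed`** — THE HEAD (`RoofAt` shape, readers abstract as in ★ `roof_transport_along_iso`).

## References
* [MumfordAV1970] D. Mumford, *Abelian Varieties* (1970), §7 Thm. 4 (p. 72), §15 Thm. 1 (p. 143), §23 Thm. 2 (p. 231).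
* [Conrad2004GrossZagier] B. Conrad, *Gross–Zagier revisited*, MSRI Publ. 49 (2004), §7 (Thm. 7.5).
* [RapoportSmithlingZhang2020Diagonal] M. Rapoport, B. Smithling, W. Zhang, *Arithmetic diagonal cycles on unitary Shimura varieties*, Compositio Math. 156 (2020), §4.3 (4.23) (p. 21).
* [Kottwitz1992] R. E. Kottwitz, *Points on some Shimura varieties over finite fields*, JAMS 5 (1992), §5 (pp. 389–391).
* [MilneCM2006] J. S. Milne, *Complex Multiplication* (2006), §7 (Def. 7.19–Rem. 7.23, pp. 58–59).
* Tree: ★ `SerreTensorHomOfIdealFamily`, ★ `QuotientDualPairKernelLawOfIdealClass`, ★ `RoofMiddleDualOfIdealTorsionQuotient`, ★ `SerreTensorIdealTranslationKernel`.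
-/

noncomputable section

-- Mathlib's `Over`/pull-back API is stated across semireducible wrappers (as in the ★ `AbelianSchemes/*` files).
set_option backward.isDefEq.respectTransparency false

universe u

open CategoryTheory CategoryTheory.Limits AlgebraicGeometry MonoidalCategory CartesianMonoidalCategory
open scoped MonObj nonZeroDivisors NumberField

namespace Literature.AlgebraicGeometry.AbelianSchemes

namespace AbelianSchemeOver

open Literature.AlgebraicGeometry.Motives Literature.AlgebraicGeometry.AbelianVarieties
open Literature.NumberTheory.NumberFields

variable {Ω : Type u} [Field Ω] [IsAlgClosed Ω] {A₁ A₂ : AbelianSchemeOver (Spec (.of Ω))} [IsCommMonObj A₂.X]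
  {F : Type} [Field F] [NumberField F] (act₁ : 𝓞 F → (A₁.X ⟶ A₁.X)) (act₂ : A₂.RingAction (𝓞 F)) (c : 𝓞 F ≃+* 𝓞 F)
  (h : 𝓞 F → (A₁.X ⟶ A₂.X)) {𝔭 : Ideal (𝓞 F)} {m : ℕ} (E' : Matrix (Fin m) (Fin m) (𝓞 F)) (hE' : E' * E' = E') (P : Matrix (Fin m) (Fin 1) (𝓞 F))
  (Q : Matrix (Fin 1) (Fin m) (𝓞 F)) {N : ℕ}
  (D₁ : A₁.DualPair) (D₂ : A₂.DualPair)
  (hD₁ : Nonempty ((Scheme.Modules.pullback (DualPair.unitHatSlice D₁)).obj D₁.P ≅ SheafOfModules.unit _))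
  (hD₂ : Nonempty ((Scheme.Modules.pullback (DualPair.unitHatSlice D₂)).obj D₂.P ≅ SheafOfModules.unit _))
  (lam₁ : A₁.X ⟶ D₁.hat.X) (lam₂ : A₂.X ⟶ D₂.hat.X) [IsMonHom lam₁] [IsMonHom lam₂]
  {J : Type*} (pt₁ : J → A₁.toAffine.toAbelianVariety.Points Ω) (pt₂ : J → A₂.toAffine.toAbelianVariety.Points Ω)
  (tors : A₂.toAffine.toAbelianVariety.Points Ω → Prop) (K : Subgroup (A₁.toAffine.toAbelianVariety.Points Ω))

include hD₂ in
/-- **THE MIDDLE DATA OF THE SERRE TENSOR OVER AN ALGEBRAICALLY CLOSED FIELD**: for a polarised `(A₂, D₂, λ₂)` of relative dimension `g` with an `𝓞 F`-action satisfying the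
Rosati law for an involution `c`, a Serre presentation `(E′, P, Q, N)` of `𝔟 ≅ 𝔭⁻¹` (`𝔭 ≠ 0`, coordinates of `P` generating `𝔭`), `𝔭·c(𝔭)·𝔡 = (N)` and a level `M ≥ 1` divisible by
the characteristic: **there are a dual pair `D_𝔟` of `A₂ ⊗_𝒪 𝔟` with unit pin and a homomorphism `λ_𝔟` with `ψ_P ≫ λ_𝔟 ≫ ψ_P^∨ = λ₂ ≫ [N]`** — ★
`exists_idealClass_quotient_kernelLaw_dualPair` (the quotient `A₂ ∕ A₂[𝔟′]`, `𝔟′ = x·𝔭`, its dual pair and kernel law) fed to ★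
`exists_dualPair_comp_lam_comp_dualIsogenyOver_eq_mulN_of_kernelLaws'` at the cover `ψ_P` (★ `surjective_serreTranslate_left`, ★ `comp_serreTranslate_eq_one_iff_forall_mem`).
[cite: MumfordAV1970, §15 Thm. 1 (p. 143); §23 Thm. 2 (p. 231); §7 Thm. 4 (p. 72)] [cite: Conrad2004GrossZagier, §7 (Thm. 7.5)] [cite: MilneCM2006, §7 (pp. 58–59)] -/
theorem exists_serreTensor_dualPair_coverExact {g : ℕ} (hA₂ : A₂.IsOfRelDim g)
    (hpol₂ : ∀ ⦃Ω' : Type u⦄ [Field Ω'] [IsAlgClosed Ω'] (s : Spec (.of Ω') ⟶ Spec (.of Ω)),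
      ∃ Θ : CartierDivisor (A₂.fibre s).toAbelianVariety.X.left, Θ.IsAmple ∧ A₂.IsLambdaOfAt s D₂ lam₂ Θ)
    (hcc : ∀ y : 𝓞 F, c (c y) = y)
    (hros : ∀ b : 𝓞 F, haveI := act₂.isMonHom b; act₂.i (c b) ≫ lam₂ = lam₂ ≫ DualPair.dualIsogenyOver (act₂.i b) D₂ D₂)
    (h𝔭0 : 𝔭 ≠ ⊥) {M : ℕ} (hM : M ≠ 0) (hchar : ∀ q : ℕ, q.Prime → (q : Ω) = 0 → q ∣ M)
    (hN : N ≠ 0) (hP : E' * P = P) (hQ : Q * E' = Q)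
    (hQP : Q * P = Matrix.scalar (Fin 1) (N : 𝓞 F)) (hPQ : P * Q = Matrix.scalar (Fin m) (N : 𝓞 F) * E')
    (h𝔭 : Ideal.span (Set.range fun k => P k 0) = 𝔭)
    (𝔡 : Ideal (𝓞 F)) (hpd : 𝔭 * 𝔭.map (c : 𝓞 F →+* 𝓞 F) * 𝔡 = Ideal.span {(N : 𝓞 F)}) :
    ∃ (DB : (serreTensor act₂ E' hE').DualPair)
      (_ : Nonempty ((Scheme.Modules.pullback (DualPair.unitHatSlice DB)).obj DB.P ≅ SheafOfModules.unit _))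
      (lamB : (serreTensor act₂ E' hE').X ⟶ DB.hat.X) (_ : IsMonHom lamB),
      serreTranslate act₂ E' hE' P ≫ lamB ≫
        (haveI := isMonHom_serreTranslate act₂ E' hE' P; DualPair.dualIsogenyOver (serreTranslate act₂ E' hE' P) D₂ DB) =
      lam₂ ≫ D₂.hat.mulN N := by
  haveI := A₂.isSeparated_hom_comp_id
  haveI := A₂.locallyOfFiniteType_hom_comp_id
  haveI := isMonHom_serreTranslate act₂ E' hE' P
  haveI : Surjective (serreTranslate act₂ E' hE' P).left := surjective_serreTranslate_left act₂ E' hE' P Q hN hP hQ hQP hPQ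
  -- (ρ-𝔟) the quotient package in the class of `𝔭`
  obtain ⟨x, 𝔟, n, Kq, hfin, DQ, hx0, h𝔟0, hcls, -, -, -, -, -, -, hker, hpin⟩ :=
    A₂.exists_idealClass_quotient_kernelLaw_dualPair D₂ hA₂ lam₂ hpol₂ act₂ c (fun b _ => hros b) 𝔭 h𝔭0 hM hchar
  haveI := hfin
  -- the fppf properties of `q_K` (free finite quotient over a field)
  haveI hqmon : IsMonHom (show A₂.X ⟶ (A₂.quotientBy (𝟙 (Spec (.of Ω))) Kq (A₂.hcov_of_field Kq)
      (A₂.exists_grpObj_isMonHom_quotientMk_of_field Kq (A₂.hcov_of_field Kq))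
      (A₂.smooth_quotientOver_hom_of_field Kq (A₂.hcov_of_field Kq))
      (A₂.geometricallyConnected_quotientOver_hom (𝟙 (Spec (.of Ω))) Kq (A₂.hcov_of_field Kq))).X from
      A₂.quotientMk (𝟙 (Spec (.of Ω))) Kq (A₂.hcov_of_field Kq)) :=
    A₂.isMonHom_quotientMk (𝟙 (Spec (.of Ω))) Kq (A₂.hcov_of_field Kq) _ _ _
  have hflat : Flat (show A₂.X ⟶ (A₂.quotientBy (𝟙 (Spec (.of Ω))) Kq (A₂.hcov_of_field Kq)
      (A₂.exists_grpObj_isMonHom_quotientMk_of_field Kq (A₂.hcov_of_field Kq))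
      (A₂.smooth_quotientOver_hom_of_field Kq (A₂.hcov_of_field Kq))
      (A₂.geometricallyConnected_quotientOver_hom (𝟙 (Spec (.of Ω))) Kq (A₂.hcov_of_field Kq))).X from
      A₂.quotientMk (𝟙 (Spec (.of Ω))) Kq (A₂.hcov_of_field Kq)).left :=
    A₂.flat_quotientMk_left (𝟙 (Spec (.of Ω))) Kq (A₂.hcov_of_field Kq) (A₂.translation_free_of_field Kq)
  have hsurj : Surjective (show A₂.X ⟶ (A₂.quotientBy (𝟙 (Spec (.of Ω))) Kq (A₂.hcov_of_field Kq)
      (A₂.exists_grpObj_isMonHom_quotientMk_of_field Kq (A₂.hcov_of_field Kq))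
      (A₂.smooth_quotientOver_hom_of_field Kq (A₂.hcov_of_field Kq))
      (A₂.geometricallyConnected_quotientOver_hom (𝟙 (Spec (.of Ω))) Kq (A₂.hcov_of_field Kq))).X from
      A₂.quotientMk (𝟙 (Spec (.of Ω))) Kq (A₂.hcov_of_field Kq)).left :=
    A₂.surjective_quotientMk_left (𝟙 (Spec (.of Ω))) Kq (A₂.hcov_of_field Kq)
  have hqc : QuasiCompact (show A₂.X ⟶ (A₂.quotientBy (𝟙 (Spec (.of Ω))) Kq (A₂.hcov_of_field Kq)
      (A₂.exists_grpObj_isMonHom_quotientMk_of_field Kq (A₂.hcov_of_field Kq))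
      (A₂.smooth_quotientOver_hom_of_field Kq (A₂.hcov_of_field Kq))
      (A₂.geometricallyConnected_quotientOver_hom (𝟙 (Spec (.of Ω))) Kq (A₂.hcov_of_field Kq))).X from
      A₂.quotientMk (𝟙 (Spec (.of Ω))) Kq (A₂.hcov_of_field Kq)).left := by
    haveI := A₂.isAffineHom_quotientMk_left (𝟙 (Spec (.of Ω))) Kq (A₂.hcov_of_field Kq)
    infer_instance
  -- (ρ-𝔟) the downstairs dual of the roof middle at the cover `ψ_P`
  exact exists_dualPair_comp_lam_comp_dualIsogenyOver_eq_mulN_of_kernelLaws' act₂ c D₂ hD₂ lam₂ _ DQ hpin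
    (serreTranslate act₂ E' hE' P) hcc hros h𝔟0 h𝔭0 hker hflat hsurj hqc
    (fun T t => comp_serreTranslate_eq_one_iff_forall_mem act₂ E' hE' P hP h𝔭 t) hx0 hcls 𝔡 hpd

include hE' hD₁ hD₂ in
/-- **THE ISOGENY ROOF OF A `𝔭`-FAMILY OF HOMOMORPHISMS OVER AN ALGEBRAICALLY CLOSED FIELD — NO DUAL-PAIR INPUT (organ (O-B), §4).**  Same letters as ★
`exists_roof_of_idealHomFamily` (the family `h` with `hmon hadd hlin heq`, the similitude law at `N` `hsim`, the level law `hlvl`, the readers `K`∕`tors`∕`pt`), plus the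
polarisation data of `A₂` (`hA₂ hpol₂ hcc hros`), `𝔭 ≠ 0`, the level `M` (`hM hchar`) and `𝔭·c(𝔭)·𝔡 = (N)`: THEN `A₁ —q→ B ←c— A₂` is an isogeny roof with the clauses
(r1)(r2)(surjective)(r3)(r3)(r4)(r5) of `RoofAt` for SOME middle `(B, D_B, λ_B)` (namely `B = A₂ ⊗_𝒪 𝔟`, `c = ψ_P`, `(D_B, λ_B)` from `exists_serreTensor_dualPair_coverExact`).
[cite: RapoportSmithlingZhang2020Diagonal, §4.3 (4.23) (p. 21)] [cite: Kottwitz1992, §5 (pp. 389–391)] [cite: MumfordAV1970, §23 Thm. 2 (p. 231); §15 Thm. 1 (p. 143)]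
[cite: Conrad2004GrossZagier, §7 (Thm. 7.5)] -/
theorem exists_roof_of_idealHomFamily_of_isAlgClosed {g : ℕ} (hA₂ : A₂.IsOfRelDim g)
    (hpol₂ : ∀ ⦃Ω' : Type u⦄ [Field Ω'] [IsAlgClosed Ω'] (s : Spec (.of Ω') ⟶ Spec (.of Ω)),
      ∃ Θ : CartierDivisor (A₂.fibre s).toAbelianVariety.X.left, Θ.IsAmple ∧ A₂.IsLambdaOfAt s D₂ lam₂ Θ)
    (hcc : ∀ y : 𝓞 F, c (c y) = y)
    (hros : ∀ b : 𝓞 F, haveI := act₂.isMonHom b; act₂.i (c b) ≫ lam₂ = lam₂ ≫ DualPair.dualIsogenyOver (act₂.i b) D₂ D₂)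
    (h𝔭0 : 𝔭 ≠ ⊥) {M : ℕ} (hM : M ≠ 0) (hchar : ∀ q : ℕ, q.Prime → (q : Ω) = 0 → q ∣ M)
    (𝔡 : Ideal (𝓞 F)) (hpd : 𝔭 * 𝔭.map (c : 𝓞 F →+* 𝓞 F) * 𝔡 = Ideal.span {(N : 𝓞 F)})
    (hN : N ≠ 0) (hP : E' * P = P) (hQ : Q * E' = Q)
    (hQP : Q * P = Matrix.scalar (Fin 1) (N : 𝓞 F)) (hPQ : P * Q = Matrix.scalar (Fin m) (N : 𝓞 F) * E')
    (h𝔭 : Ideal.span (Set.range fun k => P k 0) = 𝔭)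
    (hmon : ∀ π ∈ 𝔭, IsMonHom (h π)) (hadd : ∀ π ∈ 𝔭, ∀ π' ∈ 𝔭, h (π + π') = h π * h π')
    (hlin : ∀ (x : 𝓞 F), ∀ π ∈ 𝔭, h (x * π) = h π ≫ act₂.i x)
    (heq : ∀ (x : 𝓞 F), ∀ π ∈ 𝔭, act₁ x ≫ h π = h π ≫ act₂.i x)
    (hsim : haveI := hmon (N : 𝓞 F) (natCast_mem_of_mul_eq_scalar P Q hQP h𝔭);
      h (N : 𝓞 F) ≫ lam₂ ≫ DualPair.dualIsogenyOver (h (N : 𝓞 F)) D₁ D₂ = lam₁ ≫ D₁.hat.mulN (N ^ 2))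
    (hlvl : ∀ (i : J), ∀ π ∈ 𝔭, (AlgPoints.map (h π) (pt₁ i) : A₂.toAffine.toAbelianVariety.Points Ω) = AlgPoints.map (act₂.i π) (pt₂ i))
    (hK : ∀ Pt, Pt ∈ K ↔ ∀ π ∈ 𝔭, (AlgPoints.map (h π) Pt : A₂.toAffine.toAbelianVariety.Points Ω) = 1)
    (htors : ∀ Pt, tors Pt ↔ ∀ a ∈ 𝔭, (AlgPoints.map (act₂.i a) Pt : A₂.toAffine.toAbelianVariety.Points Ω) = 1) :
    ∃ (B : AbelianSchemeOver (Spec (.of Ω))) (DB : B.DualPair) (lamB : B.X ⟶ DB.hat.X) (_ : IsMonHom lamB)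
        (_ : Nonempty ((Scheme.Modules.pullback DB.unitHatSlice).obj DB.P ≅ SheafOfModules.unit _))
        (q : A₁.X ⟶ B.X) (_ : IsMonHom q) (c : A₂.X ⟶ B.X) (_ : IsMonHom c),
        (∀ Pt : A₁.toAffine.toAbelianVariety.Points Ω,
            (AlgPoints.map q Pt : B.toAffine.toAbelianVariety.Points Ω) = 1 ↔ Pt ∈ K) ∧
        (∀ Pt : A₂.toAffine.toAbelianVariety.Points Ω,
            (AlgPoints.map c Pt : B.toAffine.toAbelianVariety.Points Ω) = 1 ↔ tors Pt) ∧
        Function.Surjective c.left.base ∧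
        q ≫ lamB ≫ DualPair.dualIsogenyOver q D₁ DB = lam₁ ≫ D₁.hat.mulN N ∧
        c ≫ lamB ≫ DualPair.dualIsogenyOver c D₂ DB = lam₂ ≫ D₂.hat.mulN N ∧
        (∀ a : 𝓞 F, ∃ b : B.X ⟶ B.X, act₁ a ≫ q = q ≫ b ∧ act₂.i a ≫ c = c ≫ b) ∧
        (∀ i : J, (AlgPoints.map q (pt₁ i) : B.toAffine.toAbelianVariety.Points Ω) = AlgPoints.map c (pt₂ i)) := by
  obtain ⟨DB, hDB, lamB, hlamB, hc3⟩ := exists_serreTensor_dualPair_coverExact act₂ c E' hE' P Q D₂ hD₂ lam₂ hA₂ hpol₂ hcc hros h𝔭0 hM hchar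
    hN hP hQ hQP hPQ h𝔭 𝔡 hpd
  haveI := hlamB
  exact exists_roof_of_idealHomFamily act₁ act₂ h E' hE' P Q D₁ D₂ DB hD₁ hD₂ hDB lam₁ lam₂ lamB pt₁ pt₂ tors K hN hP hQ hQP hPQ h𝔭
    hmon hadd hlin heq hsim hc3 hlvl hK htors

end AbelianSchemeOver

end Literature.AlgebraicGeometry.AbelianSchemes

end
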